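import Summits.ValiantsHypothesis.ValiantsHypothesis.Theorems.BarrierLeverAnchoredDoorHitsLowerPairsStarSpec
import Summits.ValiantsHypothesis.ValiantsHypothesis.Theorems.BarrierLeverAnchoredDoorHitsLowerPairsStubGenericPoint

/-!
# Support item `AnchoredDoorHitsLowerPairs` (stmt-ValiantsHypothesis-22510), line `anchored-peeling`:
# the CROSSED-TAILS member of the anchored door, and CONJECTURE X as a typed stub

Helper file (`--supports stmt-ValiantsHypothesis-22510`; cell valiant-natproofs, rung V4, 𝒟-side door (c); registered line
`Cruxes/AnchoredDoorHitsLowerPairs/Lines/anchored_peeling.lean` v10; prover seat val-np-p1 gen 18). Bookkeeping `def`s (`CParam`, `crossedFactor`,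
`crossedWitness`, `crossedDet`, `vtx`, `crossEval`), one stub text `Stmt.stub_crossed` (OFFERED to the planner under D-0145; NOT asserted), and the
landed transfer. Closes NO item.

THE MEMBER (memo HOME/val-np-p1/g18/DTS-MEMO-valnp1-g18.md §6). Specialise the symbolic door 𝔄₁: keep only the VERTEX anchors `({a} | {c})` with
`θ_{ac}`, and let the tails of an anchor be governed by the OPPOSITE endpoint — `φ_{(ac), b} := π_{c b}` (the `x`-tail depends on the column vertex)
and `ψ_{(ac), d} := μ_{a d}` (the `y`-tail depends on the row vertex):
`𝔛 = ∏_{a,c} (1 + θ_{ac} x_a y_c ∏_{b ≠ a}(1 + π_{cb} x_b) ∏_{d ≠ c}(1 + μ_{ad} y_d))`, i.e. `𝔛 = exp(Σ_{a,c} θ_{ac} x_a y_c e^{ℓ_c(x) + m_a(y)})`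
in the squarefree algebra, with `3h²` parameters instead of `h² + 2h³`. In the algebraic form of U1 (memo §6) its door elements are
`F_U = Σ_{∅≠A⊆U} Σ_{τ:U∖A→A} ∏_{a∈A} λ_a^{(τ⁻¹a)} e^{m_a}`, `λ_a^{(S)} = Σ_c θ_{ac} (∏_{b∈S} π_{cb}) y_c`.

* `crossedDet h r u w` — the layout minor of `𝔛`;  `symbolicDet_ne_zero_of_crossedDet_ne_zero` — **TRANSFER**: `crossedDet ≠ 0 ⇒ symbolicDet s ≠ 0`
  for every `s ≥ 1` (evaluation is a ring map; `map crossEval (symbolicWitness s h) = crossedWitness h`).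
* `Stmt.stub_crossed` — **CONJECTURE X**: every injective simplicial-complex pair has `crossedDet ≠ 0`. EVIDENCE (kit j298736, random parameters
  mod p, 3 trials): nonsingular on ALL 2 590 pairs ≤ 4×4, all 33 480 + 33 480 pairs 5×4 / 4×5 and all 84 314 pairs 5×5 (iso classes of `R` × all `C`)
  — exactly the pairs where the full door is nonsingular (all of them); the REVERSED crossing (`φ` governed by `a`, `ψ` by `c`) fails on 832 / 25 830 /
  50 605 of them and the uncrossed forms (`φ_{a b}`, or `φ = 0`) on 416 / 1 570 / 24 390 / 25 750; complete-graph-vs-cube pairs = kit j298811. WHY IT MIGHT FAIL: it is a proper specialisation of U1 (fewer parameters); the dropped dependences (`φ` on the row anchor, `ψ` on the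
  column anchor) are exactly the ones that are provably USELESS one at a time (memo §6 (b)), not jointly. CHEAPEST FALSIFIER: one lower pair with
  `crossedDet = 0` at two random parameter points (lab/variants.py variant `('a','c')`, milliseconds at `h ≤ 5`).
* `stub_symbolicNonvanishing_of_crossed`, `anchoredHit_of_crossed` — Conjecture X ⟹ the line's stub (`s := 1`, `h₀ := 0`) ⟹ the item's hit.

WHAT THIS IS NOT: no claim that Conjecture X holds; nothing on crux stmt-ValiantsHypothesis-14610 or on `VP` versus `VNP`.
-/

set_option linter.dupNamespace false

namespace Summit.ValiantsHypothesis.ValiantsHypothesis.Theorems.BarrierLever.AnchoredPeeling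

open Finset MvPolynomial
open Summit.ValiantsHypothesis.ValiantsHypothesis.Theorems.BarrierLever.BrickCalculus (pexpo pexpo_def)

noncomputable section

variable {h : ℕ}

/-- Parameters of the crossed member: `θ_{ac}`, `π_{cb}`, `μ_{ad}`. -/
abbrev CParam (h : ℕ) : Type := (Fin h × Fin h) ⊕ (Fin h × Fin h) ⊕ (Fin h × Fin h)

/-- The factor of the vertex anchor `(a | c)` in the crossed member. -/
def crossedFactor (h : ℕ) (a c : Fin h) : MvPolynomial (Fin (h + h)) (MvPolynomial (CParam h) ℂ) :=
  1 + C (X (Sum.inl (a, c))) * X (Fin.castAdd h a) * X (Fin.natAdd h c) *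
    (∏ b ∈ univ \ {a}, (1 + C (X (Sum.inr (Sum.inl (c, b)))) * X (Fin.castAdd h b))) *
    (∏ d ∈ univ \ {c}, (1 + C (X (Sum.inr (Sum.inr (a, d)))) * X (Fin.natAdd h d)))

/-- **The crossed-tails member** `𝔛 = ∏_{a,c} crossedFactor a c`. -/
def crossedWitness (h : ℕ) : MvPolynomial (Fin (h + h)) (MvPolynomial (CParam h) ℂ) :=
  ∏ p : Fin h × Fin h, crossedFactor h p.1 p.2

/-- The layout minor of the crossed member on the layout `(u, w)`. -/
def crossedDet (h r : ℕ) (u w : Fin r → Finset (Fin h)) : MvPolynomial (CParam h) ℂ :=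
  (Matrix.of fun i j : Fin r => coeff (pexpo (u i) (w j)) (crossedWitness h)).det

/-- **STUB (CONJECTURE X).** The crossed member hits every injective simplicial-complex pair. -/
def Stmt.stub_crossed : Prop :=
  ∀ (h r : ℕ) (u w : Fin r → Finset (Fin h)), Function.Injective u → Function.Injective w →
    IsLowerSet (Set.range u) → IsLowerSet (Set.range w) → crossedDet h r u w ≠ 0

/-! ## The specialisation `symbolicWitness ↦ crossedWitness` -/

/-- The vertex anchor of a pair of vertices. -/
def vtx (p : Fin h × Fin h) : Finset (Fin h) × Finset (Fin h) := ({p.1}, {p.2})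

/-- `vtx` is injective. -/
theorem vtx_injective : Function.Injective (vtx (h := h)) := by
  intro p q hpq
  simp only [vtx, Prod.mk.injEq, Finset.singleton_inj] at hpq
  exact Prod.ext hpq.1 hpq.2

/-- Vertex anchors have profile `1`. -/
theorem vtx_mem_anchors {s : ℕ} (hs : 1 ≤ s) (p : Fin h × Fin h) : vtx p ∈ anchors s h := by
  simp only [vtx, anchors, Finset.mem_filter, Finset.mem_univ, true_and, Finset.card_singleton]
  omega

/-- The evaluation of the door parameters defining the crossed member. -/
def crossEval : Param h → MvPolynomial (CParam h) ℂ
  | Sum.inl α => if hα : ∃ p : Fin h × Fin h, vtx p = α then X (Sum.inl (Classical.choose hα)) else 0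
  | Sum.inr (Sum.inl (α, b)) => if hα : ∃ p : Fin h × Fin h, vtx p = α then X (Sum.inr (Sum.inl ((Classical.choose hα).2, b))) else 0
  | Sum.inr (Sum.inr (α, d)) => if hα : ∃ p : Fin h × Fin h, vtx p = α then X (Sum.inr (Sum.inr ((Classical.choose hα).1, d))) else 0

/-- `crossEval` on `θ` of a vertex anchor. -/
theorem crossEval_theta (a c : Fin h) : crossEval (Sum.inl (({a}, {c}) : Finset (Fin h) × Finset (Fin h))) = X (Sum.inl (a, c)) := by
  have hα : ∃ q : Fin h × Fin h, vtx q = ({a}, {c}) := ⟨(a, c), rfl⟩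
  have hq : Classical.choose hα = (a, c) := vtx_injective (Classical.choose_spec hα)
  rw [crossEval, dif_pos hα, hq]

/-- `crossEval` on an `x`-twist of a vertex anchor. -/
theorem crossEval_phi (a c b : Fin h) :
    crossEval (Sum.inr (Sum.inl ((({a}, {c}) : Finset (Fin h) × Finset (Fin h)), b))) = X (Sum.inr (Sum.inl (c, b))) := by
  have hα : ∃ q : Fin h × Fin h, vtx q = ({a}, {c}) := ⟨(a, c), rfl⟩
  have hq : Classical.choose hα = (a, c) := vtx_injective (Classical.choose_spec hα)
  rw [crossEval, dif_pos hα, hq]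

/-- `crossEval` on a `y`-twist of a vertex anchor. -/
theorem crossEval_psi (a c d : Fin h) :
    crossEval (Sum.inr (Sum.inr ((({a}, {c}) : Finset (Fin h) × Finset (Fin h)), d))) = X (Sum.inr (Sum.inr (a, d))) := by
  have hα : ∃ q : Fin h × Fin h, vtx q = ({a}, {c}) := ⟨(a, c), rfl⟩
  have hq : Classical.choose hα = (a, c) := vtx_injective (Classical.choose_spec hα)
  rw [crossEval, dif_pos hα, hq]

/-- `crossEval` kills `θ_α` for every non-vertex anchor. -/
theorem crossEval_theta_of_not (α : Finset (Fin h) × Finset (Fin h)) (hα : ¬ ∃ p : Fin h × Fin h, vtx p = α) :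
    crossEval (Sum.inl α) = 0 := by
  rw [crossEval, dif_neg hα]

/-- The ring map of the specialisation. -/
def crossHom : MvPolynomial (Param h) ℂ →+* MvPolynomial (CParam h) ℂ := (aeval crossEval).toRingHom

/-- `crossHom` on a variable. -/
theorem crossHom_X (v : Param h) : crossHom (X v) = crossEval v := by
  rw [crossHom, AlgHom.toRingHom_eq_coe, RingHom.coe_coe, aeval_X]

/-- `crossHom` fixes constants. -/
theorem crossHom_C (c : ℂ) : crossHom (h := h) (C c) = C c := by
  rw [crossHom, AlgHom.toRingHom_eq_coe, RingHom.coe_coe, ← algebraMap_eq, AlgHom.commutes, algebraMap_eq]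

/-- A vertex-anchor factor of the door maps to the crossed factor. -/
theorem map_crossHom_symbFactor_vtx (a c : Fin h) :
    MvPolynomial.map crossHom (symbFactor h ({a}, {c})) = crossedFactor h a c := by
  have h1 : MvPolynomial.map (crossHom (h := h))
      (∏ b ∈ univ \ {a}, (1 + C (X (Sum.inr (Sum.inl ((({a}, {c}) : Finset (Fin h) × Finset (Fin h)), b)))) * X (Fin.castAdd h b)) :
        MvPolynomial (Fin (h + h)) (MvPolynomial (Param h) ℂ)) =
      ∏ b ∈ univ \ {a}, (1 + C (X (Sum.inr (Sum.inl (c, b)))) * X (Fin.castAdd h b)) := by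
    rw [map_prod]
    refine Finset.prod_congr rfl (fun b _ => ?_)
    rw [map_add, map_one, map_mul, map_C, map_X, crossHom_X, crossEval_phi]
  have h2 : MvPolynomial.map (crossHom (h := h))
      (∏ d ∈ univ \ {c}, (1 + C (X (Sum.inr (Sum.inr ((({a}, {c}) : Finset (Fin h) × Finset (Fin h)), d)))) * X (Fin.natAdd h d)) :
        MvPolynomial (Fin (h + h)) (MvPolynomial (Param h) ℂ)) =
      ∏ d ∈ univ \ {c}, (1 + C (X (Sum.inr (Sum.inr (a, d)))) * X (Fin.natAdd h d)) := by
    rw [map_prod]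
    refine Finset.prod_congr rfl (fun d _ => ?_)
    rw [map_add, map_one, map_mul, map_C, map_X, crossHom_X, crossEval_psi]
  rw [symbFactor, crossedFactor, map_add, map_one, map_mul, map_mul, map_mul, map_mul, h2, h1, map_C, crossHom_X, crossEval_theta,
    Finset.prod_singleton, Finset.prod_singleton, map_X, map_X]

/-- A non-vertex factor of the door maps to `1`. -/
theorem map_crossHom_symbFactor_of_not (α : Finset (Fin h) × Finset (Fin h)) (hα : ¬ ∃ p : Fin h × Fin h, vtx p = α) :
    MvPolynomial.map crossHom (symbFactor h α) = 1 := by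
  rw [symbFactor, map_add, map_one, mul_assoc, mul_assoc, mul_assoc, map_mul, map_C, crossHom_X, crossEval_theta_of_not α hα, C_0,
    zero_mul, add_zero]

/-- **The specialisation of the witness is the crossed member.** -/
theorem map_crossHom_symbolicWitness {s : ℕ} (hs : 1 ≤ s) :
    MvPolynomial.map crossHom (symbolicWitness s h) = crossedWitness h := by
  classical
  rw [symbolicWitness_eq_prod, map_prod, crossedWitness]
  have hsub : (univ.image (vtx (h := h))) ⊆ anchors s h := by
    intro α hα
    obtain ⟨p, -, rfl⟩ := Finset.mem_image.mp hα
    exact vtx_mem_anchors hs p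
  rw [← Finset.prod_subset hsub]
  · rw [Finset.prod_image (fun p _ q _ hpq => vtx_injective hpq)]
    exact Finset.prod_congr rfl (fun p _ => map_crossHom_symbFactor_vtx p.1 p.2)
  · intro α _ hα
    refine map_crossHom_symbFactor_of_not α ?_
    rintro ⟨p, rfl⟩
    exact hα (Finset.mem_image.mpr ⟨p, Finset.mem_univ _, rfl⟩)

/-- The specialisation maps the symbolic minor to the crossed minor (`s ≥ 1`). -/
theorem crossHom_symbolicDet {s r : ℕ} (hs : 1 ≤ s) (u w : Fin r → Finset (Fin h)) :
    crossHom (symbolicDet s h r u w) = crossedDet h r u w := by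
  rw [symbolicDet, RingHom.map_det, crossedDet]
  congr 1
  ext i j
  rw [RingHom.mapMatrix_apply, Matrix.map_apply, Matrix.of_apply, Matrix.of_apply, ← pexpo_def, ← coeff_map,
    map_crossHom_symbolicWitness hs]

/-- **TRANSFER.** A nonzero crossed minor certifies the symbolic minor at every profile `s ≥ 1`. -/
theorem symbolicDet_ne_zero_of_crossedDet_ne_zero {s r : ℕ} (hs : 1 ≤ s) (u w : Fin r → Finset (Fin h))
    (hne : crossedDet h r u w ≠ 0) : symbolicDet s h r u w ≠ 0 := by
  intro h0
  apply hne
  rw [← crossHom_symbolicDet hs u w, h0, map_zero]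

/-- **Conjecture X implies the line's symbolic non-vanishing stub** (`s := 1`, `h₀ := 0`). -/
theorem stub_symbolicNonvanishing_of_crossed (H : Stmt.stub_crossed) : Stmt.stub_symbolicNonvanishing :=
  ⟨1, 0, fun h _ r u w hu hw hlu hlw => symbolicDet_ne_zero_of_crossedDet_ne_zero le_rfl u w (H h r u w hu hw hlu hlw)⟩

/-- Profile-1 form, in the shape the skeleton's compositions use. -/
theorem symbolicDet_one_ne_zero_of_crossed (H : Stmt.stub_crossed) (h r : ℕ) (u w : Fin r → Finset (Fin h))
    (hu : Function.Injective u) (hw : Function.Injective w) (hlu : IsLowerSet (Set.range u)) (hlw : IsLowerSet (Set.range w)) :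
    symbolicDet 1 h r u w ≠ 0 :=
  symbolicDet_ne_zero_of_crossedDet_ne_zero le_rfl u w (H h r u w hu hw hlu hlw)

/-- Hence an anchored hit at every profile `s ≥ 1` (the landed `stub_genericPoint`). -/
theorem anchoredHit_of_crossed (H : Stmt.stub_crossed) {s r : ℕ} (hs : 1 ≤ s) (h : ℕ) (u w : Fin r → Finset (Fin h))
    (hu : Function.Injective u) (hw : Function.Injective w) (hlu : IsLowerSet (Set.range u)) (hlw : IsLowerSet (Set.range w)) :
    AnchoredHit s h r u w :=
  stub_genericPoint s h r u w (symbolicDet_ne_zero_of_crossedDet_ne_zero hs u w (H h r u w hu hw hlu hlw))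

/-! ## Appendix (val-np-p1 g18, same session): total nonsingularity of the crossed member — CONJECTURE TX

`Stmt.stub_crossedTotal` — **CONJECTURE TX** (OFFERED, not asserted): the crossed layout minor is nonzero for EVERY pair of injective families
with matched emptiness (`∅` is a row iff `∅` is a column) — no simplicial-complex hypothesis; i.e. the matrix of the crossed member on nonempty
sets is TOTALLY NONSINGULAR. TX ⟹ the registered TU1 stub's conclusion for the full door (`symbolicDet 1 ≠ 0`), by the transfer above.
EVIDENCE: 0 singular among 2 030 random square minors with matched emptiness at `h = 3..6`, `r ≤ 20` (lab/tx.py, tx2.py), beside the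
≈ 160 000 lower pairs of Conjecture X. CHEAPEST FALSIFIER: one singular square minor (two random parameter points), lab/tx2.py. -/

/-- **STUB (CONJECTURE TX).** Total nonsingularity of the crossed member under matched emptiness. -/
def Stmt.stub_crossedTotal : Prop :=
  ∀ (h r : ℕ) (u w : Fin r → Finset (Fin h)), Function.Injective u → Function.Injective w →
    ((∃ i, u i = ∅) ↔ (∃ j, w j = ∅)) → crossedDet h r u w ≠ 0

/-- TX implies Conjecture X (lower pairs have matched emptiness: `∅` lies on both sides once `r ≥ 1`). -/
theorem stub_crossed_of_crossedTotal (H : Stmt.stub_crossedTotal) : Stmt.stub_crossed := by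
  intro h r u w hu hw hlu hlw
  refine H h r u w hu hw ?_
  rcases Nat.eq_zero_or_pos r with hr | hr
  · subst hr
    exact ⟨fun ⟨i, _⟩ => i.elim0, fun ⟨j, _⟩ => j.elim0⟩
  · have hu0 : (∅ : Finset (Fin h)) ∈ Set.range u := hlu (Finset.empty_subset (u ⟨0, hr⟩)) ⟨⟨0, hr⟩, rfl⟩
    have hw0 : (∅ : Finset (Fin h)) ∈ Set.range w := hlw (Finset.empty_subset (w ⟨0, hr⟩)) ⟨⟨0, hr⟩, rfl⟩
    obtain ⟨i, hi⟩ := hu0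
    obtain ⟨j, hj⟩ := hw0
    exact ⟨fun _ => ⟨j, hj⟩, fun _ => ⟨i, hi⟩⟩

/-- TX implies total nonsingularity of the full symbolic door at every profile `s ≥ 1` (the shape of the registered TU1 stub). -/
theorem symbolicDet_ne_zero_of_crossedTotal (H : Stmt.stub_crossedTotal) {s r : ℕ} (hs : 1 ≤ s) (u w : Fin r → Finset (Fin h))
    (hu : Function.Injective u) (hw : Function.Injective w) (hm : (∃ i, u i = ∅) ↔ (∃ j, w j = ∅)) : symbolicDet s h r u w ≠ 0 :=
  symbolicDet_ne_zero_of_crossedDet_ne_zero hs u w (H h r u w hu hw hm)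

end

end Summit.ValiantsHypothesis.ValiantsHypothesis.Theorems.BarrierLever.AnchoredPeeling
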